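import Literature.NumberTheory.LFunctions.Zhang2022.RepairSlopeLDL
import Literature.NumberTheory.LFunctions.Zhang2022.RepairSection18Slopes
import Literature.NumberTheory.LFunctions.Zhang2022.RepairTiePoints
import Literature.NumberTheory.LFunctions.Zhang2022.RepairCoverFrame

/-!
# Zhang (2022) §18-margin repair rung: the margin floor on a tie-line cell (kernel leaf of annex K1)

Trunk T-ANT (NumberTheory/LFunctions). Y. Zhang, arXiv:2211.02515v1 [Zhang2022LandauSiegel] — an
unrefereed manuscript under adjudication; nothing here asserts its Theorems 1–2. Rung F-S1R (D-0077),
LOCAL ANNEX K1 of RULING R3: «ONE certified tie segment around θ₀». The TIE LINE of the admissible class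
(PARAMS v2 / `Repair.AdmissibleTheta`) is the one-parameter family of designs
`θ(t) = (ν₁ = t, ν₂ = ½, ν₃ = ¾ − t/2; k = (3/2, 5/2, 3/2); ι free; cut₁ = ½)` (`thetaTie t ι` of `RepairTiePoints`, the tie family of record), on which
`L₆ = ν₂ − ν₃` so that every derived-literal binding coincides; `t = 0.504` is the printed design.

A CELL is an interval `T ∋ t` with rational centre `c`. This file assembles, per cell, the ten entries of
the margin matrix as SLOPE FORMS in `t` (`tieEntryS`: `cDiagS/cCrossS` of `RepairSection9Slopes`,
`F··TS` of `RepairSection18Slopes`), proves they enclose the exact entries of p1/p3's θ-generic functional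
of record along the path (`tieEntryS_mem`), and runs the `LDLᴴ` elimination in slope arithmetic
(`RepairSlopeLDL.EntryS.pivotsPosS`, the sharpened leaf). The per-cell theorem `C232D_ge_on_cell`: if the Boolean leaf test
`tieCellPos m T c` is `true` then for EVERY `t ∈ T` and EVERY `ι ∈ ℂ³`,
`m ≤ C232D (thetaTie t ι)` — the reading-of-record functional `C232D = C232T θ (𝔠₁T θ) (𝔠₂T θ)`
of `RepairFrakc12Theta`. A 1-D cover of a segment is then a kd-tree of cells over coordinate `0`
(`tieLeafOK`, `C232D_ge_of_tieCover`), checked by `decide +kernel` in the certificate files.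

No facts, no axioms beyond the standard three; nothing about Theorems 1–2 or Landau–Siegel zeros.
-/

noncomputable section

open Complex Real ComplexConjugate Matrix
open scoped ComplexOrder
open Literature.Analysis.ValidatedNumerics (Box KdCert)
open Literature.Analysis.ValidatedNumerics.Numerics

namespace Literature.NumberTheory.LFunctions.Zhang2022

namespace Repair

/-! ### The tie line -/

/- The tie family `thetaTie (ν₁ : ℝ) (w₂ w₃ w₄ : ℂ) : Theta` = `(ν₁, ½, ¾ − ν₁/2; 3/2, 5/2, 3/2; w; ½)` is
`RepairTiePoints.thetaTie` (p6, the tie family of record); this file only adds its slope-form cells. -/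

variable {T : FI} {c : ℚ}

/-- slope form of `ν₁ = t` on the cell [cite: Moore1966, §4.4] -/
def tieSV1 (T : FI) (c : ℚ) : SFI := SFI.var T c
/-- slope form of `ν₂ = ½` [cite: Moore1966, §4.4] -/
def tieSV2 : SFI := SFI.const (FI.ofRat (1/2))
/-- slope form of `ν₃ = ¾ − t/2` [cite: Moore1966, §4.4] -/
def tieSV3 (T : FI) (c : ℚ) : SFI := (SFI.const (FI.ofRat (3/4))).sub ((SFI.var T c).scaleRat (1/2))

/-- `ν₁(t) = t ∈ tieSV1` [cite: Moore1966, §4.4] -/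
theorem mem_tieSV1 (w2 w3 w4 : ℂ) :
    SFI.Mem T c (fun t => (thetaTie t w2 w3 w4).nu1) (tieSV1 T c) := SFI.mem_var
/-- `ν₂ = ½ ∈ tieSV2` [cite: Moore1966, §4.4] -/
theorem mem_tieSV2 (w2 w3 w4 : ℂ) :
    SFI.Mem T c (fun t => (thetaTie t w2 w3 w4).nu2) tieSV2 :=
  (SFI.mem_const (T := T) (c := c) (FI.mem_ofRat (1/2))).congr fun t => by
    show (1 / 2 : ℝ) = ((1/2 : ℚ) : ℝ); norm_num
/-- `ν₃(t) = ¾ − t/2 ∈ tieSV3` [cite: Moore1966, §4.4] -/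
theorem mem_tieSV3 (w2 w3 w4 : ℂ) :
    SFI.Mem T c (fun t => (thetaTie t w2 w3 w4).nu3) (tieSV3 T c) :=
  (SFI.mem_sub (SFI.mem_const (T := T) (c := c) (FI.mem_ofRat (3/4))) (SFI.mem_scaleRat SFI.mem_var (1/2))).congr
    fun t => by show (3 / 4 - t / 2 : ℝ) = ((3/4 : ℚ) : ℝ) - ((1/2 : ℚ) : ℝ) * t; push_cast; ring

/-- the validity flags of the §18 slice on the cell [folklore] -/
def tieSliceOK (T : FI) (c : ℚ) : Bool := slice18SOK (3/2) (5/2) (3/2) (tieSV1 T c) tieSV2 (tieSV3 T c) T c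

/-- the tie path satisfies `SlopePath` on any cell whose flags hold [cite: Zhang2022LandauSiegel, §2 (2.21)–(2.22)] -/
theorem slopePath_tie (w2 w3 w4 : ℂ) (h : tieSliceOK T c = true) :
    SlopePath T c (fun t => thetaTie t w2 w3 w4) (3/2) (5/2) (3/2) (tieSV1 T c) tieSV2 (tieSV3 T c) where
  m1 := mem_tieSV1 w2 w3 w4
  m2 := mem_tieSV2 w2 w3 w4
  m3 := mem_tieSV3 w2 w3 w4
  hk1 := fun _ => by show (3 / 2 : ℝ) = ((3/2 : ℚ) : ℝ); norm_num
  hk2 := fun _ => by show (5 / 2 : ℝ) = ((5/2 : ℚ) : ℝ); norm_num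
  hk3 := fun _ => by show (3 / 2 : ℝ) = ((3/2 : ℚ) : ℝ); norm_num
  k1_ne := by norm_num
  k2_ne := by norm_num
  k3_ne := by norm_num
  ok := h

/-! ### The ten entries on a cell, as slope forms and as exact functions -/

/-- **the entry slope forms on the cell** (`c₂₂ = c₄₄` is the constant `cDiag (5/2) ½`, still carried as a
slope form). [cite: Zhang2022LandauSiegel, (2.32), §§8–9, §18] -/
def tieEntryS (T : FI) (c : ℚ) : EntryS where
  r11 := (cDiagS (3/2) (tieSV1 T c) T c).reS
  r22 := (cDiagS (5/2) tieSV2 T c).reS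
  r33 := (cDiagS (3/2) (tieSV3 T c) T c).reS
  c12 := cCrossS (3/2) (5/2) (tieSV1 T c) tieSV2 T c
  c34 := cCrossS (5/2) (3/2) tieSV2 (tieSV3 T c) T c
  F20 := F20TS (3/2) (3/2) (tieSV1 T c) (tieSV3 T c) T c
  F21 := F21TS (5/2) (3/2) tieSV2 (tieSV3 T c) T c
  F30 := F30TS (3/2) (5/2) (tieSV1 T c) tieSV2 T c
  F31 := F31TS (5/2) tieSV2 T c

/-- **the exact entries along the path** (reading of record: derived prefactor `c₃₄ = cCross k₂ k₃ ν₂ ν₃`).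
[cite: Zhang2022LandauSiegel, (2.32), §§8–9, §18] -/
def tieEntryF (w2 w3 w4 : ℂ) : EntryF where
  r11 := fun t => (cDiag (3/2) t).re
  r22 := fun _ => (cDiag (5/2) (1 / 2 : ℝ)).re
  r33 := fun t => (cDiag (3/2) (3 / 4 - t / 2 : ℝ)).re
  c12 := fun t => cCross (3/2) (5/2) t (1 / 2 : ℝ)
  c34 := fun t => cCross (5/2) (3/2) (1 / 2 : ℝ) (3 / 4 - t / 2 : ℝ)
  F20 := fun t => F20T (thetaTie t w2 w3 w4)
  F21 := fun t => F21T (thetaTie t w2 w3 w4)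
  F30 := fun t => F30T (thetaTie t w2 w3 w4)
  F31 := fun t => F31T (thetaTie t w2 w3 w4)

/-- the validity flags of all ten entry slope forms [folklore] -/
def tieCellOK (T : FI) (c : ℚ) : Bool :=
  bDiagValSOK (3/2) (tieSV1 T c) T c && bDiagValSOK (5/2) tieSV2 T c && bDiagValSOK (3/2) (tieSV3 T c) T c
    && cCrossSOK (3/2) (5/2) (tieSV1 T c) tieSV2 T c && cCrossSOK (5/2) (3/2) tieSV2 (tieSV3 T c) T c
    && tieSliceOK T c

/-- **the entry slope forms enclose the exact entries on the cell** (for every `ι`).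
[cite: Moore1966, §4.4] -/
theorem tieEntryS_mem (w2 w3 w4 : ℂ) (h : tieCellOK T c = true) :
    EntryS.Mem T c (tieEntryF w2 w3 w4) (tieEntryS T c) := by
  unfold tieCellOK at h
  simp only [Bool.and_eq_true] at h
  obtain ⟨⟨⟨⟨⟨h1, h2⟩, h3⟩, h12⟩, h34⟩, hs⟩ := h
  have P := slopePath_tie w2 w3 w4 hs
  refine ⟨?_, ?_, ?_, ?_, ?_, P.smem_F20T, P.smem_F21T, P.smem_F30T, P.smem_F31T⟩
  · exact SCB.mem_reS (smem_cDiag (ν := fun t => t) (by norm_num) (mem_tieSV1 (T := T) (c := c) w2 w3 w4) h1)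
  · exact SCB.mem_reS (smem_cDiag (ν := fun _ => (1 / 2 : ℝ)) (by norm_num)
      (mem_tieSV2 (T := T) (c := c) w2 w3 w4) h2)
  · exact SCB.mem_reS (smem_cDiag (ν := fun t => (3 / 4 - t / 2 : ℝ)) (by norm_num)
      (mem_tieSV3 (T := T) (c := c) w2 w3 w4) h3)
  · exact smem_cCross (νL := fun t => t) (νS := fun _ => (1 / 2 : ℝ)) (by norm_num) (by norm_num) (by norm_num)
      (mem_tieSV1 (T := T) (c := c) w2 w3 w4) (mem_tieSV2 (T := T) (c := c) w2 w3 w4) h12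
  · exact smem_cCross (νL := fun _ => (1 / 2 : ℝ)) (νS := fun t => (3 / 4 - t / 2 : ℝ)) (by norm_num) (by norm_num)
      (by norm_num) (mem_tieSV2 (T := T) (c := c) w2 w3 w4) (mem_tieSV3 (T := T) (c := c) w2 w3 w4) h34

/-! ### The leaf test and the per-cell floor -/

/-- **THE LEAF TEST of annex K1**: entry flags ∧ `LDLᴴ` pivots positive on the cell (all in slope
arithmetic). [cite: Rump2006, §1] -/
def tieCellPos (m : ℚ) (T : FI) (c : ℚ) : Bool := tieCellOK T c && (tieEntryS T c).pivotsPosS m T c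

/-- a real `c_μμ` equals the cast of its real part [cite: Zhang2022LandauSiegel, §8 after (8.23)] -/
private theorem cDiag_ofReal_re (k : ℚ) (ν : ℝ) : (((cDiag k ν).re : ℝ) : ℂ) = cDiag k ν :=
  Complex.conj_eq_iff_re.1 (conj_cDiag k ν)

/-- **The margin floor on a cell of the tie line**: if `tieCellPos m T c` then for every `t ∈ T` and
every `ι = (w₂, w₃, w₄) ∈ ℂ³` the reading-of-record functional satisfies `m ≤ C232D(θ_tie(t; ι))`.
[cite: Zhang2022LandauSiegel, (2.32), §18 p.99] -/
theorem C232D_ge_on_cell {m : ℚ} (h : tieCellPos m T c = true) {t : ℝ} (ht : FI.mem t T) (w2 w3 w4 : ℂ) :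
    (m : ℝ) ≤ C232D (thetaTie t w2 w3 w4) := by
  unfold tieCellPos at h
  rw [Bool.and_eq_true] at h
  have hb := EntryS.blocks_ge_on_cell_S (tieEntryS_mem w2 w3 w4 h.1) h.2 ht w2 w3 w4
  -- identify the three blocks with `𝔠₁T`, `𝔠₂T`, `2 Re 𝔠₃ʳT` at `θ = thetaTie t ι`
  have hk1 : (thetaTie t w2 w3 w4).k1 = ((3/2 : ℚ) : ℝ) := by show (3 / 2 : ℝ) = _; norm_num
  have hk2 : (thetaTie t w2 w3 w4).k2 = ((5/2 : ℚ) : ℝ) := by show (5 / 2 : ℝ) = _; norm_num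
  have hk3 : (thetaTie t w2 w3 w4).k3 = ((3/2 : ℚ) : ℝ) := by show (3 / 2 : ℝ) = _; norm_num
  have hn1 : (thetaTie t w2 w3 w4).nu1 = t := rfl
  have hn2 : (thetaTie t w2 w3 w4).nu2 = (1 / 2 : ℝ) := rfl
  have hn3 : (thetaTie t w2 w3 w4).nu3 = (3 / 4 - t / 2 : ℝ) := rfl
  have hi2 : (thetaTie t w2 w3 w4).iota2 = w2 := rfl
  have hi3 : (thetaTie t w2 w3 w4).iota3 = w3 := rfl
  have hi4 : (thetaTie t w2 w3 w4).iota4 = w4 := rfl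
  have e1 : frakc1T (thetaTie t w2 w3 w4) = (((cDiag (3/2) t).re : ℝ) : ℂ) + w2 * conj (cCross (3/2) (5/2) t (1 / 2 : ℝ))
      + conj w2 * cCross (3/2) (5/2) t (1 / 2 : ℝ)
      + (Complex.normSq w2 : ℂ) * (((cDiag (5/2) (1 / 2 : ℝ)).re : ℝ) : ℂ) := by
    unfold frakc1T
    rw [hk1, hk2, hn1, hn2, hi2, pairFormR_ratCast, cDiag_ofReal_re, cDiag_ofReal_re]
    unfold pairForm
    simp only [map_one, Complex.ofReal_one, one_mul]
    ring
  have e2 : frakc2T (thetaTie t w2 w3 w4) = (Complex.normSq w3 : ℂ) * (((cDiag (3/2) (3 / 4 - t / 2 : ℝ)).re : ℝ) : ℂ)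
      + w3 * conj w4 * cCross (5/2) (3/2) (1 / 2 : ℝ) (3 / 4 - t / 2 : ℝ)
      + w4 * conj w3 * conj (cCross (5/2) (3/2) (1 / 2 : ℝ) (3 / 4 - t / 2 : ℝ))
      + (Complex.normSq w4 : ℂ) * (((cDiag (5/2) (1 / 2 : ℝ)).re : ℝ) : ℂ) := by
    unfold frakc2T
    rw [hk2, hk3, hn2, hn3, hi3, hi4, pairFormR_ratCast, cDiag_ofReal_re, cDiag_ofReal_re]
    unfold pairForm
    simp only [Complex.normSq_conj, Complex.conj_conj]
    ring
  have e3 : (frakc3rT (thetaTie t w2 w3 w4)).re = (conj w3 * F20T (thetaTie t w2 w3 w4)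
      + conj w3 * w2 * F21T (thetaTie t w2 w3 w4) + conj w4 * F30T (thetaTie t w2 w3 w4)
      + conj w4 * w2 * F31T (thetaTie t w2 w3 w4)).re := by
    rw [frakc3rT_eq, hi2, hi3, hi4]
  unfold C232D C232T
  rw [e1, e2, e3]
  exact hb

/-! ### One-dimensional covers of a segment of the tie line -/

/-- **leaf check of a 1-D cover**: on the box's coordinate `0` = `ν₁ = t`, the cell `[lo, hi]` with centre
`(lo + hi)/2`. [cite: Moore1966, §4.4] -/
def tieLeafOK (m : ℚ) (B : Box) (_ : Unit) : Bool :=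
  tieCellPos m (FI.ofRatRat (B.ivl 0).1 (B.ivl 0).2) (((B.ivl 0).1 + (B.ivl 0).2) / 2)

/-- soundness of the leaf check [cite: Moore1966, §4.4] -/
theorem tieLeafOK_sound {m : ℚ} (B : Box) (a : Unit) (h : tieLeafOK m B a = true) (x : ℕ → ℝ)
    (hx : B.mem x) : ∀ w2 w3 w4 : ℂ, (m : ℝ) ≤ C232D (thetaTie (x 0) w2 w3 w4) :=
  fun w2 w3 w4 => C232D_ge_on_cell h (FI.mem_ofRatRat (hx 0).1 (hx 0).2) w2 w3 w4

/-- **The segment floor from a checked 1-D cover**: if a kd-tree of tie cells over the root box `[(a, b)]`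
passes `tieLeafOK m`, then `m ≤ C232D(θ_tie(t; ι))` for every `t ∈ [a, b]` and every `ι ∈ ℂ³`.
[cite: Zhang2022LandauSiegel, (2.32), §18 p.99] -/
theorem C232D_ge_of_tieCover {m a b : ℚ} {tr : KdCert Unit} (h : tr.check (tieLeafOK m) [(a, b)] = true)
    {t : ℝ} (hat : (a : ℝ) ≤ t) (htb : t ≤ (b : ℝ)) (w2 w3 w4 : ℂ) :
    (m : ℝ) ≤ C232D (thetaTie t w2 w3 w4) := by
  let x : ℕ → ℝ := fun i => if i = 0 then t else 0
  have hx : Box.mem [(a, b)] x := by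
    refine Box_mem_of_forall (fun i hi => ?_) (fun i hi => ?_)
    · have hi0 : i = 0 := by simpa using hi
      subst hi0
      exact ⟨by simpa [x, Box.ivl] using hat, by simpa [x, Box.ivl] using htb⟩
    · have : i ≠ 0 := by intro h0; subst h0; simp at hi
      simp [x, this]
  have := KdCert.sound (P := fun x => ∀ w2 w3 w4 : ℂ, (m : ℝ) ≤ C232D (thetaTie (x 0) w2 w3 w4))
    (fun B a hB x hx => tieLeafOK_sound B a hB x hx) tr [(a, b)] h x hx w2 w3 w4
  simpa [x] using this

end Repair

end Literature.NumberTheory.LFunctions.Zhang2022
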